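import Summits.HubbardSuperconductivity.HubbardSuperconductivity.Theorems.InfiniteVolumeFirstNoInfraredPileUpMassTransferLemmas
import Summits.HubbardSuperconductivity.HubbardSuperconductivity.Theorems.InfiniteVolumeFirstNoNormalLimitStateStubCofinalLroTransfer

/-!
# Crux `NoInfraredPileUp` (stmt-HubbardSuperconductivity-18534, route `InfiniteVolumeFirst`) —
# mass transfer III: Sub₁ "NO SLIDING CONDENSATE" — INFINITE-VOLUME MEANING AND EXACTNESS

Notation as in `InfiniteVolumeFirstNoInfraredPileUpMassTransferLemmas.lean`. The strategist's
decomposition of the crux (`Cruxes/NoInfraredPileUp/STRATEGY-CENSUS.md` §4, R1) isolates its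
load-bearing half Sub₁ "no sliding condensate" (`∀ η ∃ θ, ε, L₀ ∀ even L ≥ L₀: S_L(0) ≤ θL² ⇒
T_ε(L) ≤ ηL²`); the route needs only Sub₁. Here: what Sub₁ means in infinite volume, and why, given
the rank-2 crux, it cannot be weakened any further.
* `stub_noSliding_iff_vanishingLimitsNormal` (registered stub) — for `ψ` normalised at the even
  sides: Sub₁(ψ) ⇔ every pointwise torus-limit reached along even sides with VANISHING torus order
  densities `n_{L_j} → 0` is NORMAL (`atom ≤ 0`): no infinite-volume `d_{x²−y²}` ODLRO out of
  order-free tori;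
* `noSliding_of_hasLongRangeOrder` — long-range order along the even sides gives Sub₁ vacuously;
* `noSliding_iff_hasLongRangeOrder_of_atomPos` — EXACTNESS: if all torus-limits of `ψ` have a
  positive atom (the conclusion of `NoNormalLimitState` for `ψ`), then Sub₁(ψ) ⇔ long-range order of
  `ψ` in the summit's format;
(The resulting exact decomposition of the summit's conclusion at fixed `(U, δ)` is
`summitAt_iff_atomPos_and_noSliding` in `InfiniteVolumeFirstNoInfraredPileUpMassTransfer.lean`.)

Sources: Kennedy–Lieb–Shastry, PRL **61** (1988) 2582; Fröhlich–Simon–Spencer, CMP **50** (1976)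
79, §3; Friedli–Velenik (2017) §3.7.2, §10.4; Koma–Tasaki, J. Stat. Phys. **76** (1994) 745;
Girardeau, Phys. Fluids **5** (1962) 1468. Folklore; no definition and no named fact is introduced.
-/

noncomputable section

-- the mandated namespace `Summit.<Summit>.<Problem>.Theorems` repeats `HubbardSuperconductivity`
-- (single-problem summit, D-0017), which the `dupNamespace` linter flags on every declaration
set_option linter.dupNamespace false

namespace Summit.HubbardSuperconductivity.HubbardSuperconductivity.Theorems.NoInfraredPileUp

open Literature.MathematicalPhysics.QuantumLattice Literature.Probability.LatticeModels Matrix Finset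
  Filter
open Summit.HubbardSuperconductivity.HubbardSuperconductivity.Theorems
open scoped ComplexConjugate ComplexOrder Topology

/-! ### The zero mode and the long-range-order sequence -/

/-- `|Λ_{n+1}|⁻² Σ_{x,y∈Λ_{n+1}} G_{n+1}(x,y) = S_{n+1}(0) / (n+1)²`: the term of side `n + 1` of the
long-range-order sequence is the zero mode of the pair structure factor over `L²` (both are
`re ⟨ψ, Δ_dᴴ Δ_d ψ⟩`, over `L⁴` and `L²` respectively). Scalapino, Phys. Rep. 250 (1995) 329, §2,
eq. (2.4). [folklore] -/
theorem lroSeq_eq_pairStructureFactor_zero_div (ψ : ∀ L, Fock (Orb (FermionTorus 2 L))) (n : ℕ) :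
    (∑ x ∈ halfOpenBox 2 (n + 1), ∑ y ∈ halfOpenBox 2 (n + 1),
        torusPullback (pairFieldCorr dWaveFormFactor ψ) (n + 1) x y) /
          ((halfOpenBox 2 (n + 1)).card : ℝ) ^ 2 =
      pairStructureFactor dWaveFormFactor (n + 1) (ψ (n + 1)) 0 / ((n + 1 : ℕ) : ℝ) ^ 2 := by
  rw [torusLROSeq_pairFieldCorr_succ, pairStructureFactor_zero]
  have hL : (0 : ℝ) < ((n + 1 : ℕ) : ℝ) := by positivity
  field_simp

/-! ### Sub₁ "no sliding condensate" ⇔ no order out of order-free tori -/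

/-- **THE INFINITE-VOLUME MEANING OF "NO SLIDING CONDENSATE"** (registered stub
`stub_noSliding_iff_vanishingLimitsNormal` of crux stmt-HubbardSuperconductivity-18534). For a family
`ψ_L` normalised at the even sides the following are equivalent: (i) Sub₁(ψ) — for every `η > 0`
there are `θ, ε > 0`, `L₀` such that at every even side `L ≥ L₀` WITH `S_L(0) ≤ θL²` the window tail
is `Σ_{m≠0,|q_m|≤ε} S_L(m) ≤ ηL²`; (ii) along every strictly increasing sequence of even sides on which
the translation-averaged pair correlations converge pointwise to `C` AND the torus order densities
`|Λ_L|⁻² Σ G_L` tend to `0`, the limit is NORMAL, `liminf_R R⁻⁴ Σ_{x,y∈[0,R)²} C(x−y) ≤ 0` — no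
infinite-volume ODLRO out of order-free tori. (i ⇒ ii: the zero mode is eventually small, so the
window bound applies and the Fejér upper bound kills the atom; ii ⇒ i: bad sides for
`θ_k = ε_k = 1/(k+1)`, diagonal compactness, and `boxAvg_ge_window` in the limit give an atom `≥ η`.)
Kennedy–Lieb–Shastry, PRL 61 (1988) 2582; Friedli–Velenik (2017) §10.4; Girardeau, Phys. Fluids 5
(1962) 1468. [folklore] -/
theorem stub_noSliding_iff_vanishingLimitsNormal :
    ∀ (ψ : ∀ L, Fock (Orb (FermionTorus 2 L))), (∀ L, Even L → star (ψ L) ⬝ᵥ ψ L = 1) →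
      ((∀ η : ℝ, 0 < η → ∃ θ : ℝ, 0 < θ ∧ ∃ ε : ℝ, 0 < ε ∧ ∃ L₀ : ℕ, ∀ (L : ℕ) [NeZero L],
          Even L → L₀ ≤ L → pairStructureFactor dWaveFormFactor L (ψ L) 0 ≤ θ * (L : ℝ) ^ 2 →
            (∑ m : Fin 2 → ZMod L, if m ≠ 0 ∧ momentumNormSq L m ≤ ε ^ 2 then
                pairStructureFactor dWaveFormFactor L (ψ L) m else 0) ≤ η * (L : ℝ) ^ 2) ↔
        ∀ (Ls : ℕ → ℕ) (C : Site 2 → ℝ), StrictMono Ls → (∀ j, Even (Ls j)) →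
          (∀ x : Site 2, Tendsto (fun j : ℕ => (∑ y ∈ halfOpenBox 2 (Ls j),
              torusPullback (pairFieldCorr dWaveFormFactor ψ) (Ls j) (x + y) y) /
                ((Ls j : ℕ) : ℝ) ^ 2) atTop (𝓝 (C x))) →
            Tendsto (fun j : ℕ => (∑ x ∈ halfOpenBox 2 (Ls j), ∑ y ∈ halfOpenBox 2 (Ls j),
                torusPullback (pairFieldCorr dWaveFormFactor ψ) (Ls j) x y) /
                  ((halfOpenBox 2 (Ls j)).card : ℝ) ^ 2) atTop (𝓝 0) →
              liminf (fun R : ℕ => (∑ x ∈ halfOpenBox 2 R, ∑ y ∈ halfOpenBox 2 R,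
                C (x - y)) / ((R : ℕ) : ℝ) ^ 4) atTop ≤ 0) := by
  intro ψ hnorm
  classical
  -- the constant `C_d²`
  obtain ⟨B, hB⟩ : ∃ B : ℝ, B = (∑ e ∈ insert (0 : Site 2) unitSteps,
      ‖((dWaveFormFactor e / Real.sqrt 2 : ℝ) : ℂ)‖ * 2) ^ 2 := ⟨_, rfl⟩
  have hB0 : 0 ≤ B := by rw [hB]; positivity
  -- the long-range-order sequence and the translation-averaged pair correlations
  obtain ⟨u, hu⟩ : ∃ u : ℕ → ℝ, ∀ L, u L = (∑ x ∈ halfOpenBox 2 L, ∑ y ∈ halfOpenBox 2 L,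
      torusPullback (pairFieldCorr dWaveFormFactor ψ) L x y) / ((halfOpenBox 2 L).card : ℝ) ^ 2 :=
    ⟨_, fun _ => rfl⟩
  obtain ⟨Cavg, hCavg⟩ : ∃ Cavg : ℕ → Site 2 → ℝ, ∀ L x, Cavg L x =
      (∑ y ∈ halfOpenBox 2 L, torusPullback (pairFieldCorr dWaveFormFactor ψ) L (x + y) y) /
        ((L : ℕ) : ℝ) ^ 2 := ⟨_, fun _ _ => rfl⟩
  -- the window tail at side `n + 1` and radius `ε`
  obtain ⟨T, hT⟩ : ∃ T : ℕ → ℝ → ℝ, ∀ n ε, T n ε = ∑ m : TorusSite 2 (n + 1),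
      if m ≠ 0 ∧ momentumNormSq (n + 1) m ≤ ε ^ 2 then
        pairStructureFactor dWaveFormFactor (n + 1) (ψ (n + 1)) m else 0 := ⟨_, fun _ _ => rfl⟩
  have hu0 : ∀ L, 0 ≤ u L := fun L => by rw [hu]; exact tightnessExchange_lroSeq_nonneg ψ _
  -- `S_{n+1}(0) ≤ θ (n+1)²` iff `u (n+1) ≤ θ`
  have huS : ∀ n (θ : ℝ), pairStructureFactor dWaveFormFactor (n + 1) (ψ (n + 1)) 0 ≤
      θ * ((n + 1 : ℕ) : ℝ) ^ 2 ↔ u (n + 1) ≤ θ := by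
    intro n θ
    rw [hu, lroSeq_eq_pairStructureFactor_zero_div, div_le_iff₀ (by positivity)]
  constructor
  · -- (i) ⇒ (ii)
    intro hsub Ls C hLs hLs_even hconv hulim
    obtain ⟨b, hb⟩ : ∃ b : ℕ → ℝ, ∀ R, b R = (∑ x ∈ halfOpenBox 2 R, ∑ y ∈ halfOpenBox 2 R,
        C (x - y)) / ((R : ℕ) : ℝ) ^ 4 := ⟨_, fun _ => rfl⟩
    have hbfun : (fun R : ℕ => (∑ x ∈ halfOpenBox 2 R, ∑ y ∈ halfOpenBox 2 R, C (x - y)) /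
        ((R : ℕ) : ℝ) ^ 4) = b := funext fun R => (hb R).symm
    have hufun : (fun j : ℕ => (∑ x ∈ halfOpenBox 2 (Ls j), ∑ y ∈ halfOpenBox 2 (Ls j),
        torusPullback (pairFieldCorr dWaveFormFactor ψ) (Ls j) x y) /
          ((halfOpenBox 2 (Ls j)).card : ℝ) ^ 2) = fun j => u (Ls j) := funext fun j => (hu _).symm
    rw [hufun] at hulim
    rw [hbfun]
    have hCbd : ∀ x, |C x| ≤ B := fun x =>
      hB ▸ abs_limit_corrAvg_le ψ Ls (fun j => hnorm _ (hLs_even j)) C hconv x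
    have hb_low : ∀ R, -B ≤ b R := fun R => by
      rw [hb]; exact (abs_le.1 (abs_boxAvg_le hB0 hCbd R)).1
    have hconv' : ∀ x : Site 2, Tendsto (fun j => Cavg (Ls j) x) atTop (𝓝 (C x)) := fun x => by
      simpa only [hCavg] using hconv x
    have hbj : ∀ R : ℕ, Tendsto (fun j => (∑ x ∈ halfOpenBox 2 R, ∑ y ∈ halfOpenBox 2 R,
        Cavg (Ls j) (x - y)) / ((R : ℕ) : ℝ) ^ 4) atTop (𝓝 (b R)) := fun R => by
      rw [hb]
      exact (tendsto_finsetSum _ fun x _ => tendsto_finsetSum _ fun y _ => hconv' (x - y)).div_const _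
    by_contra hpos
    set a := liminf b atTop with ha
    have ha0 : 0 < a := not_le.1 hpos
    obtain ⟨η, hη, hηa⟩ : ∃ η : ℝ, 0 < η ∧ 5 * η ≤ a := ⟨a / 5, by linarith, by linarith⟩
    obtain ⟨θ, hθ, ε, hε, L₀, hL₀⟩ := hsub η hη
    -- the Fejér tail vanishes as `R → ∞`, and `b R > a - η` eventually
    have htail : Tendsto (fun R : ℕ => 2 * Real.pi ^ 2 * B / ((R : ℝ) ^ 2 * ε ^ 2)) atTop
        (𝓝 0) := by
      refine tendsto_const_nhds.div_atTop ?_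
      exact ((tendsto_pow_atTop two_ne_zero).comp tendsto_natCast_atTop_atTop).atTop_mul_const
        (pow_pos hε 2)
    have hbR : ∀ᶠ R in atTop, a - η < b R :=
      eventually_lt_of_lt_liminf (by rw [← ha]; linarith) (isBoundedUnder_of ⟨-B, hb_low⟩)
    obtain ⟨R, hRtail, hRb, hR1⟩ := ((htail.eventually_le_const hη).and (hbR.and
      (eventually_ge_atTop 1))).exists
    have hRpos : 0 < R := hR1
    -- pass to `j`: the block average is large, the density and hence the zero mode are small
    have hbjR : ∀ᶠ j in atTop, a - 2 * η < (∑ x ∈ halfOpenBox 2 R, ∑ y ∈ halfOpenBox 2 R,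
        Cavg (Ls j) (x - y)) / ((R : ℕ) : ℝ) ^ 4 :=
      (hbj R).eventually (lt_mem_nhds (by linarith))
    have husmall : ∀ᶠ j in atTop, u (Ls j) < min θ η :=
      hulim.eventually (gt_mem_nhds (lt_min hθ hη))
    have hev1 : ∀ᶠ j in atTop, max L₀ 1 ≤ Ls j := hLs.tendsto_atTop.eventually_ge_atTop _
    obtain ⟨j, hj, hju, hjL⟩ := (hbjR.and (husmall.and hev1)).exists
    obtain ⟨n, hn⟩ : ∃ n, Ls j = n + 1 := ⟨Ls j - 1, by omega⟩
    have hevn : Even (n + 1) := hn ▸ hLs_even j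
    have hψn : star (ψ (n + 1)) ⬝ᵥ ψ (n + 1) = 1 := hnorm (n + 1) hevn
    rw [hn] at hj hju hjL
    have hzero : pairStructureFactor dWaveFormFactor (n + 1) (ψ (n + 1)) 0 ≤
        θ * ((n + 1 : ℕ) : ℝ) ^ 2 := (huS n θ).2 (hju.le.trans (min_le_left _ _))
    have hwin := hL₀ (n + 1) hevn (by omega) hzero
    have hwin' : (∑ m : TorusSite 2 (n + 1), if m ≠ 0 ∧ momentumNormSq (n + 1) m ≤ ε ^ 2 then
        pairStructureFactor dWaveFormFactor (n + 1) (ψ (n + 1)) m else 0) /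
          ((n + 1 : ℕ) : ℝ) ^ 2 ≤ η := by rwa [div_le_iff₀ (by positivity)]
    have hf := tightnessExchange_fejer_bound ψ n hψn R hRpos ε hε
    rw [← hB, ← hu] at hf
    simp only [hCavg] at hj
    have hθη : u (n + 1) < η := hju.trans_le (min_le_right _ _)
    linarith
  · -- (ii) ⇒ (i), by contraposition: bad sides with vanishing densities force an ordered limit
    intro hnormal
    by_contra hns
    push Not at hns
    obtain ⟨η, hη, hbad⟩ := hns
    have hkpos : ∀ k : ℕ, (0 : ℝ) < 1 / ((k : ℝ) + 1) := fun k => by positivity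
    -- Step 1: bad sides `φ₀ k + 1` with `u ≤ 1/(k+1)` and a bad window of radius `1/(k+1)`
    have hfreq : ∀ k : ℕ, ∃ᶠ n in atTop, Even (n + 1) ∧ u (n + 1) ≤ 1 / ((k : ℝ) + 1) ∧
        η * ((n + 1 : ℕ) : ℝ) ^ 2 < T n (1 / ((k : ℝ) + 1)) := by
      intro k
      rw [frequently_atTop]
      intro L₀
      obtain ⟨L, inst, hLe, hLL, hLS, hLT⟩ :=
        hbad (1 / ((k : ℝ) + 1)) (hkpos k) (1 / ((k : ℝ) + 1)) (hkpos k) (L₀ + 1)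
      obtain ⟨n, rfl⟩ : ∃ n, L = n + 1 := ⟨L - 1, by have := NeZero.ne L; omega⟩
      refine ⟨n, by omega, hLe, (huS n _).1 (by convert hLS using 1), ?_⟩
      rw [hT]
      convert hLT using 1
    obtain ⟨φ₀, hφ₀, hφ₀P⟩ := extraction_forall_of_frequently hfreq
    -- Step 2: a subsequence along which `C_L` converges pointwise (diagonal argument)
    obtain ⟨K, hK⟩ : ∃ K : Set (Site 2 → ℝ), K = Set.pi Set.univ fun _ => Set.Icc (-B) B :=
      ⟨_, rfl⟩
    have hKc : IsCompact K := hK ▸ isCompact_univ_pi fun _ => isCompact_Icc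
    have hCB : ∀ k x, |Cavg (φ₀ k + 1) x| ≤ B := fun k x => by
      rw [hCavg, hB]; exact tightnessExchange_abs_corrAvg_le ψ _ (hnorm _ (hφ₀P k).1) x
    have hmem : ∀ k, (fun x => Cavg (φ₀ k + 1) x) ∈ K := fun k =>
      hK ▸ Set.mem_univ_pi.2 fun x => abs_le.1 (hCB _ x)
    obtain ⟨C, -, φ₂, hφ₂, hconv⟩ := hKc.tendsto_subseq hmem
    obtain ⟨Ls, hLs⟩ : ∃ Ls : ℕ → ℕ, ∀ j, Ls j = φ₀ (φ₂ j) + 1 := ⟨_, fun _ => rfl⟩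
    have hLs_mono : StrictMono Ls := fun i j hij => by
      rw [hLs, hLs]
      exact Nat.succ_lt_succ (hφ₀ (hφ₂ hij))
    have hLs_even : ∀ j, Even (Ls j) := fun j => hLs j ▸ (hφ₀P (φ₂ j)).1
    have hLs_conv : ∀ x : Site 2, Tendsto (fun j => Cavg (Ls j) x) atTop (𝓝 (C x)) := fun x =>
      (tendsto_pi_nhds.1 hconv x).congr fun j => by simp only [Function.comp_apply, hLs]
    -- the densities vanish along `Ls` by construction
    obtain ⟨εs, hεs⟩ : ∃ εs : ℕ → ℝ, ∀ j, εs j = 1 / ((φ₂ j : ℝ) + 1) := ⟨_, fun _ => rfl⟩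
    have hεs_pos : ∀ j, 0 < εs j := fun j => by rw [hεs]; exact hkpos _
    have hεs_tend : Tendsto εs atTop (𝓝 0) := by
      have h := (tendsto_one_div_add_atTop_nhds_zero_nat (𝕜 := ℝ)).comp hφ₂.tendsto_atTop
      exact h.congr fun j => by simp only [Function.comp_apply, hεs]
    have hu_conv : Tendsto (fun j => u (Ls j)) atTop (𝓝 0) :=
      tendsto_of_tendsto_of_tendsto_of_le_of_le tendsto_const_nhds hεs_tend (fun j => hu0 _)
        fun j => by rw [hLs, hεs]; exact (hφ₀P (φ₂ j)).2.1
    -- Step 3: the limit is normal by (ii) ...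
    have hle := hnormal Ls C hLs_mono hLs_even (fun x => by simpa only [hCavg] using hLs_conv x)
      (by simpa only [hu] using hu_conv)
    -- ... but every block average of the limit is at least `η`
    have hCbd : ∀ x, |C x| ≤ B := fun x =>
      hB ▸ abs_limit_corrAvg_le ψ Ls (fun j => hnorm _ (hLs_even j)) C
        (fun x => by simpa only [hCavg] using hLs_conv x) x
    have hb_up : ∀ R : ℕ, (∑ x ∈ halfOpenBox 2 R, ∑ y ∈ halfOpenBox 2 R, C (x - y)) /
        ((R : ℕ) : ℝ) ^ 4 ≤ B := fun R => (abs_le.1 (abs_boxAvg_le hB0 hCbd R)).2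
    have hgain : ∀ R : ℕ, 0 < R →
        η ≤ (∑ x ∈ halfOpenBox 2 R, ∑ y ∈ halfOpenBox 2 R, C (x - y)) / ((R : ℕ) : ℝ) ^ 4 := by
      intro R hR
      have h4 : Tendsto (fun j => 4 * εs j * (R : ℝ)) atTop (𝓝 (4 * 0 * (R : ℝ))) :=
        (hεs_tend.const_mul 4).mul_const _
      have hlhs : Tendsto (fun j => (1 - 4 * εs j * R) * (u (Ls j) + η)) atTop
          (𝓝 ((1 - 4 * 0 * R) * (0 + η))) :=
        (h4.const_sub 1).mul (hu_conv.add_const η)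
      rw [mul_zero, zero_mul, sub_zero, one_mul, zero_add] at hlhs
      have hrhs : Tendsto (fun j => (∑ x ∈ halfOpenBox 2 R, ∑ y ∈ halfOpenBox 2 R,
          Cavg (Ls j) (x - y)) / ((R : ℕ) : ℝ) ^ 4) atTop
          (𝓝 ((∑ x ∈ halfOpenBox 2 R, ∑ y ∈ halfOpenBox 2 R, C (x - y)) / ((R : ℕ) : ℝ) ^ 4)) :=
        (tendsto_finsetSum _ fun x _ => tendsto_finsetSum _ fun y _ => hLs_conv (x - y)).div_const _
      refine le_of_tendsto_of_tendsto hlhs hrhs ?_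
      have hsmall : ∀ᶠ j in atTop, 4 * εs j * R ≤ 1 := by
        rw [mul_zero, zero_mul] at h4
        exact h4.eventually_le_const one_pos
      filter_upwards [hsmall] with j hj
      have hbadj := (hφ₀P (φ₂ j)).2.2
      rw [← hεs] at hbadj
      have hfe := boxAvg_ge_window ψ (φ₀ (φ₂ j)) R hR (hεs_pos j).le
      rw [← hu, ← hT] at hfe
      have hLpos : (0 : ℝ) < ((φ₀ (φ₂ j) + 1 : ℕ) : ℝ) ^ 2 := by positivity
      have hTge : η ≤ T (φ₀ (φ₂ j)) (εs j) / ((φ₀ (φ₂ j) + 1 : ℕ) : ℝ) ^ 2 := by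
        rw [le_div_iff₀ hLpos]; exact hbadj.le
      have hfac : 0 ≤ 1 - 4 * εs j * R := by linarith
      simp only [hLs, hCavg]
      calc (1 - 4 * εs j * R) * (u (φ₀ (φ₂ j) + 1) + η)
          ≤ (1 - 4 * εs j * R) * (u (φ₀ (φ₂ j) + 1) +
              T (φ₀ (φ₂ j)) (εs j) / ((φ₀ (φ₂ j) + 1 : ℕ) : ℝ) ^ 2) :=
            mul_le_mul_of_nonneg_left (by linarith) hfac
        _ ≤ _ := hfe
    have hge : η ≤ liminf (fun R : ℕ => (∑ x ∈ halfOpenBox 2 R, ∑ y ∈ halfOpenBox 2 R,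
        C (x - y)) / ((R : ℕ) : ℝ) ^ 4) atTop :=
      le_liminf_of_le (isCoboundedUnder_ge_of_le atTop hb_up)
        ((eventually_gt_atTop 0).mono fun R hR => hgain R hR)
    linarith

/-! ### Exactness of Sub₁ -/

/-- **Long-range order gives Sub₁ for free.** If the `d`-wave pair field of `ψ` has long-range
order along the even sides in the summit's format (`0 < liminf_k |Λ_{2k}|⁻² Σ G_{2k}`), then the
zero mode is eventually NOT small (`S_L(0) > θL²` with `θ` half the liminf), so the premise of Sub₁
fails at all large even sides and Sub₁ holds vacuously (with any window, say `ε = 1`).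
Scalapino, Phys. Rep. 250 (1995) 329, §2. [folklore] -/
theorem noSliding_of_hasLongRangeOrder (ψ : ∀ L, Fock (Orb (FermionTorus 2 L)))
    (hLRO : HasLongRangeOrder (fun k => halfOpenBox 2 (2 * k))
      (fun k => torusPullback (pairFieldCorr dWaveFormFactor ψ) (2 * k))) :
    ∀ η : ℝ, 0 < η → ∃ θ : ℝ, 0 < θ ∧ ∃ ε : ℝ, 0 < ε ∧ ∃ L₀ : ℕ, ∀ (L : ℕ) [NeZero L],
      Even L → L₀ ≤ L → pairStructureFactor dWaveFormFactor L (ψ L) 0 ≤ θ * (L : ℝ) ^ 2 →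
        (∑ m : Fin 2 → ZMod L, if m ≠ 0 ∧ momentumNormSq L m ≤ ε ^ 2 then
            pairStructureFactor dWaveFormFactor L (ψ L) m else 0) ≤ η * (L : ℝ) ^ 2 := by
  intro η _
  obtain ⟨u, hu⟩ : ∃ u : ℕ → ℝ, ∀ L, u L = (∑ x ∈ halfOpenBox 2 L, ∑ y ∈ halfOpenBox 2 L,
      torusPullback (pairFieldCorr dWaveFormFactor ψ) L x y) / ((halfOpenBox 2 L).card : ℝ) ^ 2 :=
    ⟨_, fun _ => rfl⟩
  have hliminf : 0 < liminf (fun k => u (2 * k)) atTop := by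
    simpa only [HasLongRangeOrder, hu] using hLRO
  have hu0 : ∀ k, 0 ≤ u (2 * k) := fun k => by rw [hu]; exact tightnessExchange_lroSeq_nonneg ψ _
  set a := liminf (fun k => u (2 * k)) atTop with ha
  have hev : ∀ᶠ k in atTop, a / 2 < u (2 * k) :=
    eventually_lt_of_lt_liminf (by rw [← ha]; linarith) (isBoundedUnder_of ⟨0, hu0⟩)
  obtain ⟨K₀, hK₀⟩ := eventually_atTop.1 hev
  refine ⟨a / 2, by linarith, 1, one_pos, 2 * K₀ + 1, fun L _ hL hLL hsmall => ?_⟩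
  exfalso
  -- the small zero mode says `u L ≤ a / 2` ...
  have hle : u L ≤ a / 2 := by
    obtain ⟨n, rfl⟩ : ∃ n, L = n + 1 := ⟨L - 1, by omega⟩
    rw [hu, lroSeq_eq_pairStructureFactor_zero_div, div_le_iff₀ (by positivity)]
    convert hsmall using 1
  -- ... but `L = 2k` with `k ≥ K₀`, where `u (2k) > a / 2`
  obtain ⟨k, rfl⟩ := hL.two_dvd
  have hlt := hK₀ k (by omega)
  linarith

/-- **EXACTNESS OF Sub₁.** For a family `ψ_L` normalised at the even sides all of whose pointwise
torus-limits (along even sides) have a POSITIVE condensate atom — the conclusion of the rank-2 crux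
`NoNormalLimitState` for this family — Sub₁ is EQUIVALENT to `d`-wave pair-field long-range order
along the even sides in the summit's format (⇒: a subsequence with vanishing densities and convergent
correlations would have a normal limit by `stub_noSliding_iff_vanishingLimitsNormal` — the route's
exchange lemma in R1 form; ⇐: `noSliding_of_hasLongRangeOrder`). Given the rank-2 crux, Sub₁ is thus
the weakest possible replacement of `NoInfraredPileUp`. Kennedy–Lieb–Shastry, PRL 61 (1988) 2582;
Fröhlich–Simon–Spencer, CMP 50 (1976) 79, §3; Koma–Tasaki, J. Stat. Phys. 76 (1994) 745.
[folklore] -/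
theorem noSliding_iff_hasLongRangeOrder_of_atomPos (ψ : ∀ L, Fock (Orb (FermionTorus 2 L)))
    (hnorm : ∀ L, Even L → star (ψ L) ⬝ᵥ ψ L = 1)
    (hatom : ∀ (Ls : ℕ → ℕ) (C : Site 2 → ℝ), StrictMono Ls → (∀ j, Even (Ls j)) →
      (∀ x : Site 2, Tendsto (fun j : ℕ => (∑ y ∈ halfOpenBox 2 (Ls j),
          torusPullback (pairFieldCorr dWaveFormFactor ψ) (Ls j) (x + y) y) / ((Ls j : ℕ) : ℝ) ^ 2)
        atTop (𝓝 (C x))) →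
        0 < liminf (fun R : ℕ => (∑ x ∈ halfOpenBox 2 R, ∑ y ∈ halfOpenBox 2 R, C (x - y)) /
          ((R : ℕ) : ℝ) ^ 4) atTop) :
    (∀ η : ℝ, 0 < η → ∃ θ : ℝ, 0 < θ ∧ ∃ ε : ℝ, 0 < ε ∧ ∃ L₀ : ℕ, ∀ (L : ℕ) [NeZero L],
        Even L → L₀ ≤ L → pairStructureFactor dWaveFormFactor L (ψ L) 0 ≤ θ * (L : ℝ) ^ 2 →
          (∑ m : Fin 2 → ZMod L, if m ≠ 0 ∧ momentumNormSq L m ≤ ε ^ 2 then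
              pairStructureFactor dWaveFormFactor L (ψ L) m else 0) ≤ η * (L : ℝ) ^ 2) ↔
      HasLongRangeOrder (fun k => halfOpenBox 2 (2 * k))
        (fun k => torusPullback (pairFieldCorr dWaveFormFactor ψ) (2 * k)) := by
  refine ⟨fun hsub => ?_, noSliding_of_hasLongRangeOrder ψ⟩
  -- the constant `C_d²`, the LRO sequence, the averaged correlations
  obtain ⟨B, hB⟩ : ∃ B : ℝ, B = (∑ e ∈ insert (0 : Site 2) unitSteps,
      ‖((dWaveFormFactor e / Real.sqrt 2 : ℝ) : ℂ)‖ * 2) ^ 2 := ⟨_, rfl⟩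
  obtain ⟨u, hu⟩ : ∃ u : ℕ → ℝ, ∀ L, u L = (∑ x ∈ halfOpenBox 2 L, ∑ y ∈ halfOpenBox 2 L,
      torusPullback (pairFieldCorr dWaveFormFactor ψ) L x y) / ((halfOpenBox 2 L).card : ℝ) ^ 2 :=
    ⟨_, fun _ => rfl⟩
  obtain ⟨Cavg, hCavg⟩ : ∃ Cavg : ℕ → Site 2 → ℝ, ∀ L x, Cavg L x =
      (∑ y ∈ halfOpenBox 2 L, torusPullback (pairFieldCorr dWaveFormFactor ψ) L (x + y) y) /
        ((L : ℕ) : ℝ) ^ 2 := ⟨_, fun _ _ => rfl⟩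
  have hgoal : HasLongRangeOrder (fun k => halfOpenBox 2 (2 * k))
      (fun k => torusPullback (pairFieldCorr dWaveFormFactor ψ) (2 * k)) ↔
      0 < liminf (fun k => u (2 * k)) atTop := by
    simp only [HasLongRangeOrder, hu]
  rw [hgoal]
  by_contra hneg
  have hlim0 : liminf (fun k => u (2 * k)) atTop ≤ 0 := not_lt.1 hneg
  have hu0 : ∀ k, 0 ≤ u (2 * k) := fun k => by rw [hu]; exact tightnessExchange_lroSeq_nonneg ψ _
  have huB : ∀ k, u (2 * k) ≤ B := fun k => by
    rw [hu, hB]; exact tightnessExchange_lroSeq_le ψ _ (hnorm _ (even_two_mul k))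
  have hCB : ∀ k x, |Cavg (2 * k) x| ≤ B := fun k x => by
    rw [hCavg, hB]; exact tightnessExchange_abs_corrAvg_le ψ _ (hnorm _ (even_two_mul k)) x
  -- Step 1: a subsequence of even sides along which the LRO sequence tends to `0`
  have hfreq : ∀ N : ℕ, ∃ᶠ k in atTop, u (2 * k) < 1 / ((N : ℝ) + 1) := fun N =>
    frequently_lt_of_liminf_lt (isCoboundedUnder_ge_of_le atTop huB)
      (hlim0.trans_lt (by positivity))
  obtain ⟨φ₁, hφ₁, hφ₁u⟩ := extraction_forall_of_frequently hfreq
  have hu_tend : Tendsto (fun j => u (2 * φ₁ j)) atTop (𝓝 0) :=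
    tendsto_of_tendsto_of_tendsto_of_le_of_le tendsto_const_nhds
      tendsto_one_div_add_atTop_nhds_zero_nat (fun j => hu0 _) (fun j => (hφ₁u j).le)
  -- Step 2: a further subsequence along which `C_L` converges pointwise (diagonal argument)
  obtain ⟨K, hK⟩ : ∃ K : Set (Site 2 → ℝ), K = Set.pi Set.univ fun _ => Set.Icc (-B) B :=
    ⟨_, rfl⟩
  have hKc : IsCompact K := hK ▸ isCompact_univ_pi fun _ => isCompact_Icc
  have hmem : ∀ j, (fun x => Cavg (2 * φ₁ j) x) ∈ K := fun j =>
    hK ▸ Set.mem_univ_pi.2 fun x => abs_le.1 (hCB _ x)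
  obtain ⟨C, -, φ₂, hφ₂, hconv⟩ := hKc.tendsto_subseq hmem
  obtain ⟨Ls, hLs⟩ : ∃ Ls : ℕ → ℕ, ∀ j, Ls j = 2 * φ₁ (φ₂ j) := ⟨_, fun _ => rfl⟩
  have hLs_mono : StrictMono Ls := fun a b hab => by
    have h := hφ₁ (hφ₂ hab)
    rw [hLs, hLs]
    omega
  have hLs_even : ∀ j, Even (Ls j) := fun j => hLs j ▸ even_two_mul _
  have hLs_conv : ∀ x : Site 2, Tendsto (fun j => Cavg (Ls j) x) atTop (𝓝 (C x)) := fun x =>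
    (tendsto_pi_nhds.1 hconv x).congr fun j => by simp only [Function.comp_apply, hLs]
  have hu_tend' : Tendsto (fun j => u (Ls j)) atTop (𝓝 0) :=
    (hu_tend.comp hφ₂.tendsto_atTop).congr fun j => by simp only [Function.comp_apply, hLs]
  -- Step 3: the limit is normal by Sub₁, but ordered by hypothesis
  have hconvL : ∀ x : Site 2, Tendsto (fun j : ℕ => (∑ y ∈ halfOpenBox 2 (Ls j),
      torusPullback (pairFieldCorr dWaveFormFactor ψ) (Ls j) (x + y) y) / ((Ls j : ℕ) : ℝ) ^ 2)
      atTop (𝓝 (C x)) := fun x => by simpa only [hCavg] using hLs_conv x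
  have hle := (stub_noSliding_iff_vanishingLimitsNormal ψ hnorm).1 hsub Ls C hLs_mono hLs_even
    hconvL (by simpa only [hu] using hu_tend')
  exact absurd (hatom Ls C hLs_mono hLs_even hconvL) (not_lt.2 hle)

end Summit.HubbardSuperconductivity.HubbardSuperconductivity.Theorems.NoInfraredPileUp

end
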